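import Literature.Computability.Complexity.DrivenSignMachineStrategy
import HarnessLib

/-!
# The oracle-driven sign machine, IV′: reading a history off its transcript (`histOf`, `tailOf`)

Topic `Literature/Computability/Complexity`, grouping namespace `FKTransfer`, companion of
`DrivenSignMachineStrategy.lean` (`flat code h`: the transcript occupied by a history `h` of
(witness, sign bit) pairs, frames `w ++ code h' w ++ [b]` of the fixed length `P = s + m + 1`). A
driver language is a set of transcripts `⟨1ⁿ, bits⟩`, so to DEFINE the search and verdict pieces
of a driver from a strategy one needs the inverse reading: `histOf s P bits` — the (witness, last
bit) pairs of the complete `P`-blocks of `bits` — and `tailOf P bits` — the incomplete last block.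
Main lemma **`histOf_flat_append` / `tailOf_flat_append`**: on `flat code h ++ p` with `|p| < P`
they return `h` and `p`. (So `Lsearch := {⟨1ⁿ, bits⟩ | PrefixExtendable (R n (histOf … bits)) s
(tailOf … bits ++ [1])}` satisfies the specification `hS` of `implements_driverLang` by rewriting.)

## References

* H. Fournier, P. Koiran, *Lower bounds are not easier over the reals: inside PH*, ICALP 2000,
  LNCS 1853 = LIP RR-1999-21, §2.1 (the procedure reads its own earlier outcomes). [FournierKoiran2000]
-/

namespace Literature.Computability.Complexity

namespace FKTransfer

/-! ### Blocks of a transcript -/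

section Blocks

variable (s P : ℕ)

/-- The `f`-th block of length `P` of a transcript. [folklore] -/
def blockAt (bits : List Bool) (f : ℕ) : List Bool :=
  (bits.drop (f * P)).take P

/-- **The history read off a transcript**: for each complete block, its first `s` bits (the
witness) and its last bit (the sign answer). [cite: FournierKoiran2000, §2.1] -/
def histOf (bits : List Bool) : List (List Bool × Bool) :=
  (List.range (bits.length / P)).map fun f => ((blockAt P bits f).take s, (blockAt P bits f).getLast?.getD false)

/-- **The incomplete last block** of a transcript. [folklore] -/
def tailOf (bits : List Bool) : List Bool :=
  bits.drop (bits.length / P * P)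

variable {s P}

/-- Blocks below the length of the first part do not see an appended second part. [folklore] -/
theorem blockAt_append_of_le {t u : List Bool} {f : ℕ} (h : f * P + P ≤ t.length) :
    blockAt P (t ++ u) f = blockAt P t f := by
  rw [blockAt, blockAt, List.drop_append_of_le_length (by omega), List.take_append_of_le_length]
  rw [List.length_drop]; omega

/-- The block starting exactly at the end of the first part is the first `P` bits of the second.
[folklore] -/
theorem blockAt_append_right {t u : List Bool} {f : ℕ} (h : t.length = f * P) :
    blockAt P (t ++ u) f = u.take P := by
  rw [blockAt, ← h, List.drop_left]

end Blocks

/-! ### Reading `flat code h ++ p` -/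

section Flat

variable {s m : ℕ} {code : List (List Bool × Bool) → List Bool → List Bool}

/-- **The history read off `flat code h ++ p` is `h`** (witnesses of length `s`, codes of length
`m`, `|p| < s + m + 1`). [cite: FournierKoiran2000, §2.1] -/
theorem histOf_flat_append (hcode : ∀ h w, (code h w).length = m) :
    ∀ (h : List (List Bool × Bool)) (p : List Bool), (∀ e ∈ h, e.1.length = s) → p.length < s + m + 1 →
      histOf s (s + m + 1) (flat code h ++ p) = h := by
  intro h
  induction h using List.reverseRecOn with
  | nil =>
    intro p _ hp
    simp [histOf, Nat.div_eq_of_lt hp]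
  | append_singleton h e ih =>
    intro p hs hp
    obtain ⟨w, b⟩ := e
    have hs' : ∀ e ∈ h, e.1.length = s := fun e he => hs e (List.mem_append_left _ he)
    have hw : w.length = s := hs (w, b) (by simp)
    have hl : (flat code h).length = h.length * (s + m + 1) := length_flat hcode h hs'
    have hfr : (w ++ code h w ++ [b]).length = s + m + 1 := by
      simp only [List.length_append, hw, hcode, List.length_singleton]
    -- number of complete blocks
    have hlen : (flat code (h ++ [(w, b)]) ++ p).length / (s + m + 1) = h.length + 1 := by
      rw [List.length_append, flat_append_singleton, List.length_append, hl, hfr]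
      rw [show h.length * (s + m + 1) + (s + m + 1) + p.length = p.length + (s + m + 1) * (h.length + 1) by ring,
        Nat.add_mul_div_left _ _ (by omega), Nat.div_eq_of_lt hp, Nat.zero_add]
    -- the earlier blocks are those of `flat code h`
    have key : ∀ f ∈ List.range h.length,
        blockAt (s + m + 1) (flat code (h ++ [(w, b)]) ++ p) f = blockAt (s + m + 1) (flat code h) f := by
      intro f hf
      rw [List.mem_range] at hf
      rw [flat_append_singleton, List.append_assoc, blockAt_append_of_le]
      rw [hl]
      have := Nat.mul_le_mul_right (s + m + 1) (Nat.succ_le_of_lt hf)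
      rw [Nat.succ_mul] at this
      exact this
    have ih0 := ih [] hs' (by simp)
    rw [histOf, List.append_nil, hl, Nat.mul_div_cancel _ (by omega)] at ih0
    -- the last complete block is the new frame
    have hblk : blockAt (s + m + 1) (flat code (h ++ [(w, b)]) ++ p) h.length = w ++ code h w ++ [b] := by
      rw [flat_append_singleton, List.append_assoc, blockAt_append_right hl, ← hfr, List.take_left]
    rw [histOf, hlen, List.range_succ, List.map_append, List.map_singleton]
    congr 1
    · rw [List.map_congr_left (fun f hf => by rw [key f hf])]
      exact ih0
    · rw [hblk]
      congr 1
      refine Prod.ext ?_ ?_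
      · show (w ++ code h w ++ [b]).take s = w
        rw [List.append_assoc, List.take_left' hw]
      · show (w ++ code h w ++ [b]).getLast?.getD false = b
        rw [List.getLast?_append, List.getLast?_singleton]
        rfl

/-- **The incomplete block of `flat code h ++ p` is `p`.** [folklore] -/
theorem tailOf_flat_append (hcode : ∀ h w, (code h w).length = m) (h : List (List Bool × Bool)) (p : List Bool)
    (hs : ∀ e ∈ h, e.1.length = s) (hp : p.length < s + m + 1) :
    tailOf (s + m + 1) (flat code h ++ p) = p := by
  have hl : (flat code h).length = h.length * (s + m + 1) := length_flat hcode h hs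
  have hlen : (flat code h ++ p).length / (s + m + 1) = h.length := by
    rw [List.length_append, hl, show h.length * (s + m + 1) + p.length = p.length + (s + m + 1) * h.length by ring,
      Nat.add_mul_div_left _ _ (by omega), Nat.div_eq_of_lt hp, Nat.zero_add]
  rw [tailOf, hlen, ← hl, List.drop_left]

end Flat

end FKTransfer

end Literature.Computability.Complexity
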